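import Summits.KontsevichZagierPeriods.KontsevichZagierPeriods.Theorems.SymplecticScissorsVolumeFormOffPlaneEllipsoidPairs
import Summits.KontsevichZagierPeriods.KontsevichZagierPeriods.Theorems.SymplecticScissorsVolumeFormOffPlanePointCellsWeighted
import Summits.KontsevichZagierPeriods.KontsevichZagierPeriods.Theorems.SymplecticScissorsVolumeFormOffPlanePeriodSplit
import Summits.KontsevichZagierPeriods.KontsevichZagierPeriods.Theorems.SymplecticScissorsVolumeFormOffPlaneBallVolumeTranscendental

/-!
# `VolumeFormOffPlane` (stmt-KontsevichZagierPeriods-14935) — line `Sketch`, v7: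
TWO PERIODS — K-cells ⊕ the affine orbit of ONE body of transcendental volume

The v7 layer of the line, composed from its landed stubs (`stub_pointCellsWeighted` p138811,
`stub_periodSplit` p138792, `stub_ballVolumeTranscendental` p138915) and the landed signed
scissors layer (`stub_scissors`, `stub_pairsOfDecomposition`), the Euclidean affine sector of
`OffTetraSectorKernel` (`stub_affineOrbit`):

* a K-CELL is an integrand-`1` representation `ρ` with a certificate
  `[ρ] − [pt, v] ∈ KZ.relations`, `v` real algebraic (`[pt, v] = KZ.IntegralRep.unit.constMul v hv`);
  feeders (file `…PointCells.lean`): algebraic boxes, algebraic simplices (Dirichlet peeling),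
  polynomial subgraphs over rational boxes (rule (3)), affine images and products of K-cells;
* `pointCellPairs` — two integrand-`1` representations whose domains are a.e. `ℤ`-combinations of
  K-cells, with equal volume, are KZ-equivalent (every dimension);
* `pointCellOrbitPairs` — MIXING: fix a `ℚ`-semialgebraic body `B` of finite TRANSCENDENTAL
  volume; two integrand-`1` representations whose domains are a.e. `ℤ`-combinations of K-cells
  AND of real-algebraic affine images `A B + b`, with equal volume, are KZ-equivalent — equal total
  volume `a + b·vol B = a' + b'·vol B` (`a, a', b, b' ∈ ℚ̄`) forces `a = a'` and `b = b'`
  (period splitting), and each half is a relation;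
* `pointCellBallPairs` — the instance `B = B_d`, `d ≥ 2` (`vol B_d ∉ ℚ̄` by Lindemann's theorem,
  PROVED in the tree): K-cells ⊕ real-algebraic ellipsoids, e.g. a union of algebraic polytopes
  and balls against another such union of the same volume, in every dimension `d ≥ 2` — for
  `d ≥ 3` an instance of this crux with TWO period types (`1` and `π^{⌊d/2⌋}`) in one domain.

Sources: Kontsevich–Zagier 2001, §1.2; F. Lindemann, Math. Ann. 20 (1882); folklore.
-/

noncomputable section

open MeasureTheory Set
open Literature.NumberTheory.Transcendental
open Literature.ModelTheory.ExponentialFields (IsSemialgebraic)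

namespace Summit.KontsevichZagierPeriods.SymplecticScissors.LogPolytope

/-! ## Small inputs of the period splitting -/

/-- `1` and a transcendental `ω` are linearly independent over the real algebraic numbers.
[folklore] -/
theorem tp_linIndep_of_transcendental {ω : ℝ} (hω : Transcendental ℚ ω) :
    ∀ a b : ℝ, IsAlgebraic ℚ a → IsAlgebraic ℚ b → a * 1 + b * ω = 0 → a = 0 ∧ b = 0 := by
  intro a b ha hb h
  by_cases hb0 : b = 0
  · subst hb0
    simpa using h
  · exfalso
    apply hω
    have hωeq : ω = -a * b⁻¹ := by
      field_simp
      linarith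
    rw [hωeq]
    exact ha.neg.mul hb.inv

/-- **Soundness of a K-cell certificate**: `[ρ] − [pt, v] ∈ relations` forces `value ρ = v`.
[Kontsevich–Zagier 2001, §1.2] [folklore] -/
theorem tp_value_of_cert {N : ℕ} {ρ : KZ.IntegralRep N} {v : ℝ} {hv : IsAlgebraic ℚ v}
    (h : KZ.of ρ - KZ.of (KZ.IntegralRep.unit.constMul v hv) ∈ KZ.relations) : ρ.value = v := by
  rw [KZ.Equivalent.value_eq_holds h, KZ.IntegralRep.value_constMul, KZ.IntegralRep.value_unit,
    mul_one]

/-- **Volume of a real-algebraic affine image**: an integrand-`1` representation on `A B + b`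
(`A`, `b` real algebraic, `det A ≠ 0`, `B` `ℚ`-semialgebraic of finite volume) has value
`|det A| · vol B` — one rule-(2) move to `[B, |det A|]` and soundness.
[Kontsevich–Zagier 2001, §1.2 rule (2)] [folklore] -/
theorem tp_affineImage_value {d : ℕ} {B : Set (Fin d → ℝ)} (hB : IsSemialgebraic ℚ B)
    (hBvol : volume B ≠ ⊤) {A : Matrix (Fin d) (Fin d) ℝ} {b : Fin d → ℝ}
    (hA : ∀ j l, IsAlgebraic ℚ (A j l)) (hb : ∀ j, IsAlgebraic ℚ (b j)) (hdet : A.det ≠ 0)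
    (ρ : KZ.IntegralRep d) (hdom : ρ.domain = (fun x => A.mulVec x + b) '' B)
    (hone : ∀ x ∈ ρ.domain, ρ.integrand x = 1) :
    ρ.value = |A.det| * (volume B).toReal := by
  obtain ⟨O, hOd, hOi⟩ := KZ.exists_oneRep hB hBvol
  subst hOd
  have halg : IsAlgebraic ℚ |A.det| :=
    Summit.KontsevichZagierPeriods.HyperbolicBloch.OffTetraSectorKernel.aff_orbit_isAlgebraic_abs_det hA
  have hmove : KZ.of (O.constMul |A.det| halg) - KZ.of ρ ∈ KZ.relations := by
    refine KZ.changeOfVariablesRel_subset_relations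
      (Summit.KontsevichZagierPeriods.HyperbolicBloch.OffTetraSectorKernel.aff_orbit_of_sub_of_mem_changeOfVariablesRel
        A b hA hb hdet (O.constMul |A.det| halg) ρ hdom fun x hx => ?_)
    have hx' : A.mulVec x + b ∈ ρ.domain := by
      rw [hdom]
      exact mem_image_of_mem _ hx
    simp only [hone _ hx', KZ.IntegralRep.integrand_constMul, hOi]
    ring
  rw [← KZ.Equivalent.value_eq_holds hmove, KZ.IntegralRep.value_constMul,
    O.value_eq_volume_real (fun x _ => by rw [hOi]), measureReal_def]

/-- **The `ℤ`-weighted property of the affine orbit of one body** (support-restricted form of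
`OffTetraSectorKernel.stub_affineOrbit`). [folklore] -/
theorem tp_orbit_weighted {d : ℕ} {B : Set (Fin d → ℝ)} (hB : IsSemialgebraic ℚ B)
    (hBvol : volume B ≠ ⊤) :
    ∀ (K : ℕ) (σ : Fin K → KZ.IntegralRep d) (w : Fin K → ℤ),
      (∀ j, w j ≠ 0 → (∀ x ∈ (σ j).domain, (σ j).integrand x = 1) ∧
        ∃ (A : Matrix (Fin d) (Fin d) ℝ) (b : Fin d → ℝ),
          (∀ j l, IsAlgebraic ℚ (A j l)) ∧ (∀ j, IsAlgebraic ℚ (b j)) ∧ A.det ≠ 0 ∧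
          (σ j).domain = (fun x => A.mulVec x + b) '' B) →
      ∑ j, (w j : ℝ) * (σ j).value = 0 → ∑ j, w j • KZ.of (σ j) ∈ KZ.relations := by
  refine aop_weighted_of_forall (N := d)
    (fun τ => (∀ x ∈ τ.domain, τ.integrand x = 1) ∧
      ∃ (A : Matrix (Fin d) (Fin d) ℝ) (b : Fin d → ℝ),
        (∀ j l, IsAlgebraic ℚ (A j l)) ∧ (∀ j, IsAlgebraic ℚ (b j)) ∧ A.det ≠ 0 ∧
        τ.domain = (fun x => A.mulVec x + b) '' B)
    fun K σ w hG hv => ?_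
  choose hone A b hA hb hdet hdom using hG
  exact Summit.KontsevichZagierPeriods.HyperbolicBloch.OffTetraSectorKernel.stub_affineOrbit
    d K B A b w σ hB hBvol (fun i j l => hA i j l) (fun i j => hb i j) hdet hdom hone hv

/-! ## Pairs theorems -/

/-- **POINT-CELL PAIRS (every dimension).** Two integrand-`1` representations of dimension `N`
whose domains are, almost everywhere, `ℤ`-combinations of indicators of domains of K-CELLS —
integrand-`1` representations `ρ i` carrying, where the weight is non-zero, a certificate
`[ρ i] − [pt, v] ∈ KZ.relations` with `v` real algebraic — and whose values agree are
KZ-equivalent: `stub_pairsOfDecomposition` fed with `stub_scissors` and the weighted property of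
K-cells `stub_pointCellsWeighted`. K-cells include algebraic boxes and simplices, polynomial
subgraphs over rational boxes, their real-algebraic affine images and products (file
`…PointCells.lean`). [folklore] -/
theorem pointCellPairs :
    ∀ (N : ℕ) (r r' : KZ.IntegralRep N) (k k' : ℕ) (ρ : Fin k → KZ.IntegralRep N)
        (ρ' : Fin k' → KZ.IntegralRep N) (c : Fin k → ℤ) (c' : Fin k' → ℤ),
      (∀ x ∈ r.domain, r.integrand x = 1) → (∀ x ∈ r'.domain, r'.integrand x = 1) →
      (∀ i, ∀ x ∈ (ρ i).domain, (ρ i).integrand x = 1) →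
      (∀ i, ∀ x ∈ (ρ' i).domain, (ρ' i).integrand x = 1) →
      (∀ i, c i ≠ 0 → ∃ (v : ℝ) (hv : IsAlgebraic ℚ v),
        KZ.of (ρ i) - KZ.of (KZ.IntegralRep.unit.constMul v hv) ∈ KZ.relations) →
      (∀ i, c' i ≠ 0 → ∃ (v : ℝ) (hv : IsAlgebraic ℚ v),
        KZ.of (ρ' i) - KZ.of (KZ.IntegralRep.unit.constMul v hv) ∈ KZ.relations) →
      (∀ᵐ x : Fin N → ℝ, r.domain.indicator (fun _ => (1 : ℝ)) x =
        ∑ i, (c i : ℝ) * (ρ i).domain.indicator (fun _ => (1 : ℝ)) x) →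
      (∀ᵐ x : Fin N → ℝ, r'.domain.indicator (fun _ => (1 : ℝ)) x =
        ∑ i, (c' i : ℝ) * (ρ' i).domain.indicator (fun _ => (1 : ℝ)) x) →
      r.value = r'.value → KZ.Equivalent r r' := by
  intro N r r' k k' ρ ρ' c c' hr hr' hρ hρ' hc hc' hdec hdec' hval
  refine stub_pairsOfDecomposition N
    (fun τ => ∃ (v : ℝ) (hv : IsAlgebraic ℚ v),
      KZ.of τ - KZ.of (KZ.IntegralRep.unit.constMul v hv) ∈ KZ.relations)
    (fun _ => False) (stub_scissors N) ?_
    r r' k 0 k' 0 ρ (fun ν => ν.elim0) ρ' (fun ν => ν.elim0) c (fun ν => ν.elim0)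
    c' (fun ν => ν.elim0) hr hr' hρ (fun ν => ν.elim0) hρ' (fun ν => ν.elim0) hc
    (fun ν => ν.elim0) hc' (fun ν => ν.elim0) (by simpa using hdec) (by simpa using hdec') hval
  intro K M ρB ρS cB cS hB hS hv
  have hcS : ∀ ν, cS ν = 0 := fun ν => by_contra fun h => hS ν h
  simp only [hcS, Int.cast_zero, zero_mul, Finset.sum_const_zero, add_zero, zero_smul] at hv ⊢
  exact stub_pointCellsWeighted N K ρB cB hB hv

/-- **POINT-CELL ⊕ ORBIT PAIRS (MIXING TWO PERIODS, every dimension).** Fix a `ℚ`-semialgebraic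
body `B ⊆ ℝᵈ` of finite, TRANSCENDENTAL volume. Two integrand-`1` representations of dimension
`d` whose domains are, almost everywhere, `ℤ`-combinations of indicators of domains of K-cells
(`ρB`, certificates `[ρB i] − [pt, v] ∈ relations`, `v ∈ ℚ̄`) AND of integrand-`1`
representations on real-algebraic affine images `A B + b` (`ρS`, `det A ≠ 0`), and whose values
agree, are KZ-equivalent: the values are `a·1` resp. `|det A|·vol B` with `a, |det A| ∈ ℚ̄`, and
`1, vol B` are linearly independent over `ℚ̄`, so `stub_periodSplit` joins the weighted property
of K-cells (`stub_pointCellsWeighted`) and of the orbit (`stub_affineOrbit`) into the joint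
weighted property that `stub_pairsOfDecomposition` needs. [Kontsevich–Zagier 2001, §1.2]
[folklore] -/
theorem pointCellOrbitPairs :
    ∀ (d : ℕ) (B : Set (Fin d → ℝ)), IsSemialgebraic ℚ B → volume B ≠ ⊤ →
      Transcendental ℚ (volume B).toReal →
      ∀ (r r' : KZ.IntegralRep d) (k m k' m' : ℕ)
        (ρB : Fin k → KZ.IntegralRep d) (ρS : Fin m → KZ.IntegralRep d)
        (ρB' : Fin k' → KZ.IntegralRep d) (ρS' : Fin m' → KZ.IntegralRep d)
        (cB : Fin k → ℤ) (cS : Fin m → ℤ) (cB' : Fin k' → ℤ) (cS' : Fin m' → ℤ),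
      (∀ x ∈ r.domain, r.integrand x = 1) → (∀ x ∈ r'.domain, r'.integrand x = 1) →
      (∀ i, ∀ x ∈ (ρB i).domain, (ρB i).integrand x = 1) →
      (∀ ν, ∀ x ∈ (ρS ν).domain, (ρS ν).integrand x = 1) →
      (∀ i, ∀ x ∈ (ρB' i).domain, (ρB' i).integrand x = 1) →
      (∀ ν, ∀ x ∈ (ρS' ν).domain, (ρS' ν).integrand x = 1) →
      (∀ i, cB i ≠ 0 → ∃ (v : ℝ) (hv : IsAlgebraic ℚ v),
        KZ.of (ρB i) - KZ.of (KZ.IntegralRep.unit.constMul v hv) ∈ KZ.relations) →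
      (∀ ν, cS ν ≠ 0 → ∃ (A : Matrix (Fin d) (Fin d) ℝ) (b : Fin d → ℝ),
        (∀ j l, IsAlgebraic ℚ (A j l)) ∧ (∀ j, IsAlgebraic ℚ (b j)) ∧ A.det ≠ 0 ∧
        (ρS ν).domain = (fun x => A.mulVec x + b) '' B) →
      (∀ i, cB' i ≠ 0 → ∃ (v : ℝ) (hv : IsAlgebraic ℚ v),
        KZ.of (ρB' i) - KZ.of (KZ.IntegralRep.unit.constMul v hv) ∈ KZ.relations) →
      (∀ ν, cS' ν ≠ 0 → ∃ (A : Matrix (Fin d) (Fin d) ℝ) (b : Fin d → ℝ),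
        (∀ j l, IsAlgebraic ℚ (A j l)) ∧ (∀ j, IsAlgebraic ℚ (b j)) ∧ A.det ≠ 0 ∧
        (ρS' ν).domain = (fun x => A.mulVec x + b) '' B) →
      (∀ᵐ x : Fin d → ℝ, r.domain.indicator (fun _ => (1 : ℝ)) x =
        ∑ i, (cB i : ℝ) * (ρB i).domain.indicator (fun _ => (1 : ℝ)) x +
          ∑ ν, (cS ν : ℝ) * (ρS ν).domain.indicator (fun _ => (1 : ℝ)) x) →
      (∀ᵐ x : Fin d → ℝ, r'.domain.indicator (fun _ => (1 : ℝ)) x =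
        ∑ i, (cB' i : ℝ) * (ρB' i).domain.indicator (fun _ => (1 : ℝ)) x +
          ∑ ν, (cS' ν : ℝ) * (ρS' ν).domain.indicator (fun _ => (1 : ℝ)) x) →
      r.value = r'.value → KZ.Equivalent r r' := by
  intro d B hB hBvol hT r r' k m k' m' ρB ρS ρB' ρS' cB cS cB' cS' hr hr' hρB hρS hρB' hρS'
    hcB hcS hcB' hcS' hdec hdec' hval
  refine stub_pairsOfDecomposition d
    (fun τ => ∃ (v : ℝ) (hv : IsAlgebraic ℚ v),
      KZ.of τ - KZ.of (KZ.IntegralRep.unit.constMul v hv) ∈ KZ.relations)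
    (fun τ => (∀ x ∈ τ.domain, τ.integrand x = 1) ∧
      ∃ (A : Matrix (Fin d) (Fin d) ℝ) (b : Fin d → ℝ),
        (∀ j l, IsAlgebraic ℚ (A j l)) ∧ (∀ j, IsAlgebraic ℚ (b j)) ∧ A.det ≠ 0 ∧
        τ.domain = (fun x => A.mulVec x + b) '' B)
    (stub_scissors d) ?_
    r r' k m k' m' ρB ρS ρB' ρS' cB cS cB' cS' hr hr' hρB hρS hρB' hρS' hcB
    (fun ν hν => ⟨hρS ν, hcS ν hν⟩) hcB' (fun ν hν => ⟨hρS' ν, hcS' ν hν⟩) hdec hdec' hval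
  refine stub_periodSplit d
    (fun τ => ∃ (v : ℝ) (hv : IsAlgebraic ℚ v),
      KZ.of τ - KZ.of (KZ.IntegralRep.unit.constMul v hv) ∈ KZ.relations)
    (fun τ => (∀ x ∈ τ.domain, τ.integrand x = 1) ∧
      ∃ (A : Matrix (Fin d) (Fin d) ℝ) (b : Fin d → ℝ),
        (∀ j l, IsAlgebraic ℚ (A j l)) ∧ (∀ j, IsAlgebraic ℚ (b j)) ∧ A.det ≠ 0 ∧
        τ.domain = (fun x => A.mulVec x + b) '' B)
    1 (volume B).toReal (tp_linIndep_of_transcendental hT)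
    (fun ρ hρ => ?_) (fun ρ hρ => ?_) (stub_pointCellsWeighted d) (tp_orbit_weighted hB hBvol)
  · obtain ⟨v, hv, h⟩ := hρ
    exact ⟨v, hv, by rw [tp_value_of_cert h, mul_one]⟩
  · obtain ⟨hone, A, b, hA, hb, hdet, hdom⟩ := hρ
    exact ⟨|A.det|,
      Summit.KontsevichZagierPeriods.HyperbolicBloch.OffTetraSectorKernel.aff_orbit_isAlgebraic_abs_det hA,
      tp_affineImage_value hB hBvol hA hb hdet ρ hdom hone⟩

/-- **POINT-CELL ⊕ BALL PAIRS (every dimension `d ≥ 2`; for `d ≥ 3` an instance of the crux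
with two period types in one domain).** Two integrand-`1` representations of dimension `d ≥ 2`
whose domains are, almost everywhere, `ℤ`-combinations of indicators of K-cells (algebraic boxes,
simplices, polynomial subgraphs, …) and of real-algebraic open ELLIPSOIDS `A B_d + b`, and whose
values agree, are KZ-equivalent: `pointCellOrbitPairs` for the unit ball, whose volume
`π^{d/2}/Γ(d/2+1)` is transcendental (`stub_ballVolumeTranscendental`, from Lindemann's theorem
proved in the tree). E.g. a disjoint union of algebraic polytopes and balls against another one
of the same volume. [Lindemann 1882; Kontsevich–Zagier 2001, §1.2] [folklore] -/
theorem pointCellBallPairs :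
    ∀ (d : ℕ), 2 ≤ d →
      ∀ (r r' : KZ.IntegralRep d) (k m k' m' : ℕ)
        (ρB : Fin k → KZ.IntegralRep d) (ρS : Fin m → KZ.IntegralRep d)
        (ρB' : Fin k' → KZ.IntegralRep d) (ρS' : Fin m' → KZ.IntegralRep d)
        (cB : Fin k → ℤ) (cS : Fin m → ℤ) (cB' : Fin k' → ℤ) (cS' : Fin m' → ℤ),
      (∀ x ∈ r.domain, r.integrand x = 1) → (∀ x ∈ r'.domain, r'.integrand x = 1) →
      (∀ i, ∀ x ∈ (ρB i).domain, (ρB i).integrand x = 1) →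
      (∀ ν, ∀ x ∈ (ρS ν).domain, (ρS ν).integrand x = 1) →
      (∀ i, ∀ x ∈ (ρB' i).domain, (ρB' i).integrand x = 1) →
      (∀ ν, ∀ x ∈ (ρS' ν).domain, (ρS' ν).integrand x = 1) →
      (∀ i, cB i ≠ 0 → ∃ (v : ℝ) (hv : IsAlgebraic ℚ v),
        KZ.of (ρB i) - KZ.of (KZ.IntegralRep.unit.constMul v hv) ∈ KZ.relations) →
      (∀ ν, cS ν ≠ 0 → ∃ (A : Matrix (Fin d) (Fin d) ℝ) (b : Fin d → ℝ),
        (∀ j l, IsAlgebraic ℚ (A j l)) ∧ (∀ j, IsAlgebraic ℚ (b j)) ∧ A.det ≠ 0 ∧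
        (ρS ν).domain = (fun x => A.mulVec x + b) '' {z : Fin d → ℝ | ∑ i, (z i) ^ 2 < 1}) →
      (∀ i, cB' i ≠ 0 → ∃ (v : ℝ) (hv : IsAlgebraic ℚ v),
        KZ.of (ρB' i) - KZ.of (KZ.IntegralRep.unit.constMul v hv) ∈ KZ.relations) →
      (∀ ν, cS' ν ≠ 0 → ∃ (A : Matrix (Fin d) (Fin d) ℝ) (b : Fin d → ℝ),
        (∀ j l, IsAlgebraic ℚ (A j l)) ∧ (∀ j, IsAlgebraic ℚ (b j)) ∧ A.det ≠ 0 ∧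
        (ρS' ν).domain = (fun x => A.mulVec x + b) '' {z : Fin d → ℝ | ∑ i, (z i) ^ 2 < 1}) →
      (∀ᵐ x : Fin d → ℝ, r.domain.indicator (fun _ => (1 : ℝ)) x =
        ∑ i, (cB i : ℝ) * (ρB i).domain.indicator (fun _ => (1 : ℝ)) x +
          ∑ ν, (cS ν : ℝ) * (ρS ν).domain.indicator (fun _ => (1 : ℝ)) x) →
      (∀ᵐ x : Fin d → ℝ, r'.domain.indicator (fun _ => (1 : ℝ)) x =
        ∑ i, (cB' i : ℝ) * (ρB' i).domain.indicator (fun _ => (1 : ℝ)) x +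
          ∑ ν, (cS' ν : ℝ) * (ρS' ν).domain.indicator (fun _ => (1 : ℝ)) x) →
      r.value = r'.value → KZ.Equivalent r r' := fun d hd =>
  pointCellOrbitPairs d _ (KZ.BallPeeling.isSemialgebraic_ball d) (elp_volume_ball_ne_top d)
    (stub_ballVolumeTranscendental d hd)

end Summit.KontsevichZagierPeriods.SymplecticScissors.LogPolytope

end
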